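import Mathlib.RingTheory.Polynomial.Eisenstein.Basic
import Mathlib.RingTheory.Polynomial.GaussLemma
import Mathlib.Tactic.ComputeDegree
import Mathlib.Data.ZMod.Basic
import Literature.AlgebraicGeometry.Deligne1982.WeilTypeCMFieldIsCM
import Literature.AlgebraicGeometry.HodgeTheory.WeilClassesCMReductionSplit
import HarnessLib

/-!
# A DECIDED non-split Weil-type component over a CM field of degree 4: `[3w] ≠ [1]` in
# `F^×/Nm_{E/F}(E^×)` for `E = ℚ(ζ₅) = ℚ[T]/(T⁴ + 5T² + 5)`, `F = ℚ(√5) = ℚ[S]/(S² + 5S + 5)`, `3 ∤ w`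

research route conditional on HC_CM; not a corollary; Q11.4-sentence-2 already refuted in dim ≥ 3.
Cell `pub-hodge-ring2`, seat `ring2-b03` (gen 46); kernel CERTIFICATE for the Weil-type family-coverage census
`HOME/WEIL-FAMILY-COVERAGE.md` §b03.5 (operator priority5 2026-08-22T11:46:08Z): on Deligne's carriers
(`Deligne1982/WeilTypeCMDiscriminant`: `cmField R = ℚ[T]/(R(T²))`, `realField R = ℚ[S]/(R)`,
`cmNormResidueGroup R = Fˣ ⧸ Nm_{E/F}(Eˣ)`) with `R = S² + 5S + 5` — so `E = ℚ(η)`, `η = ζ₅ - ζ₅⁻¹`,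
`η² = -(5 + √5)/2`, `E = ℚ(ζ₅)`, `F = ℚ(√5)` — the class of `3w`, `w ∈ ℤ`, `3 ∤ w`, is NOT the split class
`[(-1)²] = [1]` of `E`-rank `4` (`HodgeTheory.splitDiscriminantClassCM R 2`). Hence the components
`W8.ℚ(ζ₅).δ` of the census with `δ ∈ {[3], [6], [15], [21], [24], [30], [33], [39], …}` (abelian eightfolds of
Weil type `(2,2;2,2)` relative to `ℚ(ζ₅)` whose hermitian form has such a discriminant) are NON-SPLIT
components: they contain no member with an `E`-Lagrangian (Deligne Cor. 4.2), in particular none of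
Deligne's split members `A₀ ⊗ O_E`. This is the CM-field twin of the quadratic certificates
`Ring2.WeilCoverage.sixfold_sqrtNeg3_neg2_ne_split` etc. (ring2-b04) and the first decided instance of
`cmNormResidueGroup`.

PROOF (3-adic, elementary; the prime `3` is inert in `F` and in `E/F`): a norm `z z̄ = 3w` with
`z = a + bη ∈ E`, `a, b ∈ F`, means `a² - σ b² = 3w` in `F` (`σ = η² ∈ F` the class of `S`); in the
coordinates `a = a₀ + a₁σ`, `b = b₀ + b₁σ` this is the pair of rational equations
`a₀² - 5a₁² + 10b₀b₁ - 25b₁² = 3w`, `2a₀a₁ - 5a₁² - b₀² + 10b₀b₁ - 20b₁² = 0`; after clearing denominators,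
reduction mod `3` forces `3 ∣ a₀, a₁, b₀, b₁` (the binary form `x² - σ̄y²` over `𝔽₉ = O_F/3` is anisotropic
because `σ̄` is a non-square: an 81-case `decide`), whence `3 ∣` the denominator-clearing multiplier, and
infinite descent. No named fact, no definition, no `sorry`; nothing about the Hodge conjecture is asserted.

References: [Deligne1982HodgeCycles] §4 p. 30 (1), Cor. 4.2, Lemma 4.6; [Landherr1936HermitianForms];
J. Neukirch, Algebraic Number Theory, V (3.4) (tame symbols; only the valuation parity is used here).
-/

noncomputable section

set_option linter.dupNamespace false

open Polynomial

namespace Summit.HodgeConjecture.HodgeConjecture.Ring2.WeilCoverageCM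

open Literature.AlgebraicGeometry.Deligne1982
open Literature.AlgebraicGeometry.HodgeTheory (splitDiscriminantClassCM)


/-! ### §1 The arithmetic core: anisotropy mod 3 and descent -/

/-- **Anisotropy of `x² - σ̄ y²` over `𝔽₉ = 𝔽₃[σ]/(σ² + 5σ + 5)`** in the coordinates `x = a + bσ`,
`y = c + dσ`: the two coordinate forms vanish mod `3` only at the origin (81 cases). [folklore] -/
theorem zmod3_anisotropic :
    ∀ a b c d : ZMod 3, a ^ 2 - 5 * b ^ 2 + 10 * c * d - 25 * d ^ 2 = 0 →
      2 * a * b - 5 * b ^ 2 - c ^ 2 + 10 * c * d - 20 * d ^ 2 = 0 → a = 0 ∧ b = 0 ∧ c = 0 ∧ d = 0 := by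
  decide

/-- **Integer descent**: `A² - 5B² + 10CD - 25D² = 3wM²`, `2AB - 5B² - C² + 10CD - 20D² = 0` with `3 ∤ w`
force `M = 0` (reduce mod 3, divide everything by 3, repeat). [folklore] -/
theorem int_descent (w : ℤ) (hw : ¬ (3 : ℤ) ∣ w) :
    ∀ (n : ℕ) (A B Cc D M : ℤ), -(n : ℤ) ≤ M → M ≤ n →
      A ^ 2 - 5 * B ^ 2 + 10 * Cc * D - 25 * D ^ 2 = 3 * w * M ^ 2 →
      2 * A * B - 5 * B ^ 2 - Cc ^ 2 + 10 * Cc * D - 20 * D ^ 2 = 0 → M = 0 := by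
  intro n
  induction n with
  | zero => intro A B Cc D M h1 h2 _ _; omega
  | succ n ih =>
    intro A B Cc D M h1 h2 hX hY
    -- reduction mod 3
    have h3 : ((A : ZMod 3)) = 0 ∧ ((B : ZMod 3)) = 0 ∧ ((Cc : ZMod 3)) = 0 ∧ ((D : ZMod 3)) = 0 := by
      apply zmod3_anisotropic
      · have := congrArg (Int.cast : ℤ → ZMod 3) hX
        push_cast at this
        rw [this, show (3 : ZMod 3) = 0 from rfl]
        ring
      · have := congrArg (Int.cast : ℤ → ZMod 3) hY
        push_cast at this
        exact this
    obtain ⟨hA, hB, hC, hD⟩ := h3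
    rw [ZMod.intCast_zmod_eq_zero_iff_dvd] at hA hB hC hD
    obtain ⟨A', rfl⟩ := hA
    obtain ⟨B', rfl⟩ := hB
    obtain ⟨C', rfl⟩ := hC
    obtain ⟨D', rfl⟩ := hD
    -- `3 (A'² - 5B'² + 10C'D' - 25D'²) = w M²`, so `3 ∣ M`
    have hX' : 3 * (A' ^ 2 - 5 * B' ^ 2 + 10 * C' * D' - 25 * D' ^ 2) = w * M ^ 2 := by
      have h9 : (9 : ℤ) * (A' ^ 2 - 5 * B' ^ 2 + 10 * C' * D' - 25 * D' ^ 2) = 3 * w * M ^ 2 := by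
        rw [← hX]; ring
      linarith
    have hM3 : (3 : ℤ) ∣ M := by
      have h3 : (3 : ℤ) ∣ w * M ^ 2 := ⟨_, hX'.symm⟩
      rcases (Int.prime_three.dvd_or_dvd h3) with h | h
      · exact absurd h hw
      · exact Int.prime_three.dvd_of_dvd_pow h
    obtain ⟨M', rfl⟩ := hM3
    have hX'' : A' ^ 2 - 5 * B' ^ 2 + 10 * C' * D' - 25 * D' ^ 2 = 3 * w * M' ^ 2 := by
      have : 3 * (A' ^ 2 - 5 * B' ^ 2 + 10 * C' * D' - 25 * D' ^ 2) = 3 * (3 * w * M' ^ 2) := by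
        rw [hX']; ring
      exact mul_left_cancel₀ three_ne_zero this
    have hY'' : 2 * A' * B' - 5 * B' ^ 2 - C' ^ 2 + 10 * C' * D' - 20 * D' ^ 2 = 0 := by
      have : (9 : ℤ) * (2 * A' * B' - 5 * B' ^ 2 - C' ^ 2 + 10 * C' * D' - 20 * D' ^ 2) = 0 := by
        rw [← hY]; ring
      exact (mul_eq_zero.1 this).resolve_left (by norm_num)
    have hM' : M' = 0 := ih A' B' C' D' M' (by push_cast at h1 h2 ⊢; omega) (by push_cast at h1 h2 ⊢; omega) hX'' hY''
    rw [hM', mul_zero]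

/-- **No rational solutions**: `a₀² - 5a₁² + 10b₀b₁ - 25b₁² = 3w`, `2a₀a₁ - 5a₁² - b₀² + 10b₀b₁ - 20b₁² = 0`
has no solution in `ℚ` when `3 ∤ w` (clear denominators, `int_descent`). [folklore] -/
theorem rat_no_solution (w : ℤ) (hw : ¬ (3 : ℤ) ∣ w) (a₀ a₁ b₀ b₁ : ℚ)
    (hX : a₀ ^ 2 - 5 * a₁ ^ 2 + 10 * b₀ * b₁ - 25 * b₁ ^ 2 = 3 * w)
    (hY : 2 * a₀ * a₁ - 5 * a₁ ^ 2 - b₀ ^ 2 + 10 * b₀ * b₁ - 20 * b₁ ^ 2 = 0) : False := by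
  -- common multiplier
  set m : ℕ := a₀.den * a₁.den * b₀.den * b₁.den with hm
  have hm0 : (m : ℤ) ≠ 0 := by
    have : 0 < m := by
      rw [hm]; exact Nat.mul_pos (Nat.mul_pos (Nat.mul_pos a₀.den_pos a₁.den_pos) b₀.den_pos) b₁.den_pos
    exact_mod_cast this.ne'
  -- integer numerators of `aᵢ m`
  have key : ∀ (q : ℚ) (k : ℕ), ((q.num * k : ℤ) : ℚ) = q * (q.den * k : ℕ) := by
    intro q k
    push_cast
    rw [← mul_assoc, Rat.mul_den_eq_num]
  obtain ⟨A, hA⟩ : ∃ A : ℤ, (A : ℚ) = a₀ * m :=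
    ⟨a₀.num * (a₁.den * b₀.den * b₁.den : ℕ), by rw [key, hm]; push_cast; ring⟩
  obtain ⟨B, hB⟩ : ∃ B : ℤ, (B : ℚ) = a₁ * m :=
    ⟨a₁.num * (a₀.den * b₀.den * b₁.den : ℕ), by rw [key, hm]; push_cast; ring⟩
  obtain ⟨Cc, hC⟩ : ∃ Cc : ℤ, (Cc : ℚ) = b₀ * m :=
    ⟨b₀.num * (a₀.den * a₁.den * b₁.den : ℕ), by rw [key, hm]; push_cast; ring⟩
  obtain ⟨D, hD⟩ : ∃ D : ℤ, (D : ℚ) = b₁ * m :=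
    ⟨b₁.num * (a₀.den * a₁.den * b₀.den : ℕ), by rw [key, hm]; push_cast; ring⟩
  have hXZ : A ^ 2 - 5 * B ^ 2 + 10 * Cc * D - 25 * D ^ 2 = 3 * w * (m : ℤ) ^ 2 := by
    have h : (A : ℚ) ^ 2 - 5 * (B : ℚ) ^ 2 + 10 * (Cc : ℚ) * D - 25 * (D : ℚ) ^ 2 = 3 * w * ((m : ℤ) : ℚ) ^ 2 := by
      rw [hA, hB, hC, hD]; push_cast; linear_combination ((m : ℚ)) ^ 2 * hX
    exact_mod_cast h
  have hYZ : 2 * A * B - 5 * B ^ 2 - Cc ^ 2 + 10 * Cc * D - 20 * D ^ 2 = 0 := by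
    have h : 2 * (A : ℚ) * B - 5 * (B : ℚ) ^ 2 - (Cc : ℚ) ^ 2 + 10 * (Cc : ℚ) * D - 20 * (D : ℚ) ^ 2 = 0 := by
      rw [hA, hB, hC, hD]; linear_combination ((m : ℚ)) ^ 2 * hY
    exact_mod_cast h
  have := int_descent w hw (m : ℤ).natAbs A B Cc D m (by omega) (by omega) hXZ hYZ
  exact hm0 this

/-! ### §2 The polynomials `S² + 5S + 5` and `T⁴ + 5T² + 5` (Eisenstein at 5)

Every statement below is about Deligne's `R = S² + 5S + 5`, passed as `(hR : R = X ^ 2 + C 5 * X + C 5)` so that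
no notation or definition is introduced; consumers instantiate with `rfl`. -/

/-- `realPolyQ R = S² + 5S + 5 ∈ ℚ[S]`. [cite: Deligne1982HodgeCycles, §4 p. 30] -/
theorem realPolyQ_R5 {R : Polynomial ℤ} (hR : R = X ^ 2 + C 5 * X + C 5) :
    realPolyQ R = X ^ 2 + 5 * X + 5 := by
  subst hR
  simp [realPolyQ]

/-- `S² + 5S + 5` is Eisenstein at `5`, hence irreducible over `ℤ`. [folklore] -/
theorem irreducible_R5_int : Irreducible (X ^ 2 + C (5 : ℤ) * X + C 5 : Polynomial ℤ) := by
  have hmonic : (X ^ 2 + C (5 : ℤ) * X + C 5 : Polynomial ℤ).Monic := by monicity!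
  have hdeg : (X ^ 2 + C (5 : ℤ) * X + C 5 : Polynomial ℤ).natDegree = 2 := by compute_degree!
  have hprime : (Ideal.span {(5 : ℤ)}).IsPrime :=
    (Ideal.span_singleton_prime (by norm_num)).2 (Int.prime_iff_natAbs_prime.2 (by norm_num))
  refine Polynomial.IsEisensteinAt.irreducible (𝓟 := Ideal.span {(5 : ℤ)}) ⟨?_, ?_, ?_⟩ hprime
    hmonic.isPrimitive (by rw [hdeg]; norm_num)
  · rw [hmonic.leadingCoeff, Ideal.mem_span_singleton]; norm_num
  · intro n hn
    rw [hdeg] at hn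
    rw [Ideal.mem_span_singleton]
    interval_cases n <;> simp [coeff_X, coeff_X_pow]
  · rw [Ideal.span_singleton_pow, Ideal.mem_span_singleton]
    simp [coeff_X_pow]

/-- `T⁴ + 5T² + 5` is Eisenstein at `5`, hence irreducible over `ℤ` (so `E = ℚ[T]/(T⁴+5T²+5) = ℚ(ζ₅)` is a
field of degree 4). [folklore] -/
theorem irreducible_cmPoly_int : Irreducible (X ^ 4 + C (5 : ℤ) * X ^ 2 + C 5 : Polynomial ℤ) := by
  have hmonic : (X ^ 4 + C (5 : ℤ) * X ^ 2 + C 5 : Polynomial ℤ).Monic := by monicity!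
  have hdeg : (X ^ 4 + C (5 : ℤ) * X ^ 2 + C 5 : Polynomial ℤ).natDegree = 4 := by compute_degree!
  have hprime : (Ideal.span {(5 : ℤ)}).IsPrime :=
    (Ideal.span_singleton_prime (by norm_num)).2 (Int.prime_iff_natAbs_prime.2 (by norm_num))
  refine Polynomial.IsEisensteinAt.irreducible (𝓟 := Ideal.span {(5 : ℤ)}) ⟨?_, ?_, ?_⟩ hprime
    hmonic.isPrimitive (by rw [hdeg]; norm_num)
  · rw [hmonic.leadingCoeff, Ideal.mem_span_singleton]; norm_num
  · intro n hn
    rw [hdeg] at hn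
    rw [Ideal.mem_span_singleton]
    interval_cases n <;> simp
  · rw [Ideal.span_singleton_pow, Ideal.mem_span_singleton]
    simp

/-- `S² + 5S + 5` is irreducible over `ℚ` (Gauss's lemma): the `Fact` making `F = realField R` a field;
consumers may pass it as the instance argument of the theorems below.
[cite: Deligne1982HodgeCycles, §4 p. 30] -/
theorem fact_irreducible_realPolyQ_R5 {R : Polynomial ℤ} (hR : R = X ^ 2 + C 5 * X + C 5) :
    Fact (Irreducible (realPolyQ R)) := by
  subst hR
  refine ⟨?_⟩
  have hmonic : (X ^ 2 + C (5 : ℤ) * X + C 5 : Polynomial ℤ).Monic := by monicity!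
  have h := (hmonic.irreducible_iff_irreducible_map_fraction_map (K := ℚ)).1 irreducible_R5_int
  rw [algebraMap_int_eq] at h
  exact h

/-- `T⁴ + 5T² + 5` is irreducible over `ℚ`: the `Fact` making `E = cmField R` a field.
[cite: Deligne1982HodgeCycles, §4 p. 30] -/
theorem fact_irreducible_cmPolyQ_R5 {R : Polynomial ℤ} (hR : R = X ^ 2 + C 5 * X + C 5) :
    Fact (Irreducible (cmPolyQ R)) := by
  subst hR
  refine ⟨?_⟩
  have hmonic : (X ^ 4 + C (5 : ℤ) * X ^ 2 + C 5 : Polynomial ℤ).Monic := by monicity!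
  have h := (hmonic.irreducible_iff_irreducible_map_fraction_map (K := ℚ)).1 irreducible_cmPoly_int
  have hc : (X ^ 2 + C (5 : ℤ) * X + C 5 : Polynomial ℤ).comp (X ^ 2) =
      (X ^ 4 + C (5 : ℤ) * X ^ 2 + C 5 : Polynomial ℤ) := by
    simp only [add_comp, mul_comp, pow_comp, X_comp, C_comp]
    ring
  have e : cmPolyQ (X ^ 2 + C (5 : ℤ) * X + C 5) =
      (X ^ 4 + C (5 : ℤ) * X ^ 2 + C 5 : Polynomial ℤ).map (algebraMap ℤ ℚ) := by
    rw [algebraMap_int_eq, ← hc]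
  rw [e]
  exact h

/-! ### §3 Coordinates on `F = ℚ[S]/(S² + 5S + 5) = ℚ ⊕ ℚσ` (`σ = AdjoinRoot.root`, `ι = AdjoinRoot.of`) -/

section Coordinates

variable {R : Polynomial ℤ} [Fact (Irreducible (realPolyQ R))]

/-- `σ² + 5σ + 5 = 0` in `F`. [cite: Deligne1982HodgeCycles, §4 p. 30] -/
theorem root_rel (hR : R = X ^ 2 + C 5 * X + C 5) :
    AdjoinRoot.root (realPolyQ R) ^ 2 + 5 * AdjoinRoot.root (realPolyQ R) + 5 = 0 := by
  have h : AdjoinRoot.mk (realPolyQ R) (X ^ 2 + 5 * X + 5) = 0 := by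
    rw [← realPolyQ_R5 hR]
    exact AdjoinRoot.mk_self
  simpa [map_add, map_mul, map_pow, map_ofNat] using h

/-- `F = ℚ ⊕ ℚσ`: every element of `F` is `ι p + ι q · σ`. [cite: Deligne1982HodgeCycles, §4 p. 30] -/
theorem exists_coords (hR : R = X ^ 2 + C 5 * X + C 5) (x : realField R) :
    ∃ p q : ℚ, x = AdjoinRoot.of (realPolyQ R) p + AdjoinRoot.of (realPolyQ R) q * AdjoinRoot.root (realPolyQ R) := by
  have hmonic : (realPolyQ R).Monic := by rw [realPolyQ_R5 hR]; monicity!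
  have hdeg : (realPolyQ R).natDegree = 2 := by rw [realPolyQ_R5 hR]; compute_degree!
  have hne1 : realPolyQ R ≠ 1 := by
    intro h1
    rw [h1, natDegree_one] at hdeg
    exact absurd hdeg (by norm_num)
  induction x using AdjoinRoot.induction_on with
  | ih P =>
    have hmk : (AdjoinRoot.mk (realPolyQ R) P : realField R) =
        AdjoinRoot.mk (realPolyQ R) (P %ₘ realPolyQ R) := by
      rw [AdjoinRoot.mk_eq_mk]
      refine ⟨P /ₘ realPolyQ R, ?_⟩
      calc P - P %ₘ realPolyQ R
          = (P %ₘ realPolyQ R + realPolyQ R * (P /ₘ realPolyQ R)) - P %ₘ realPolyQ R := by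
            rw [Polynomial.modByMonic_add_div P (realPolyQ R)]
        _ = realPolyQ R * (P /ₘ realPolyQ R) := by ring
    have hrdeg : (P %ₘ realPolyQ R).natDegree ≤ 1 := by
      have := Polynomial.natDegree_modByMonic_lt P hmonic hne1
      rw [hdeg] at this
      omega
    refine ⟨(P %ₘ realPolyQ R).coeff 0, (P %ₘ realPolyQ R).coeff 1, ?_⟩
    rw [hmk]
    conv_lhs => rw [Polynomial.eq_X_add_C_of_natDegree_le_one hrdeg]
    rw [map_add, map_mul, AdjoinRoot.mk_C, AdjoinRoot.mk_C, AdjoinRoot.mk_X]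
    ring

/-- `{1, σ}` is `ℚ`-free: `ι p + ι q · σ = 0 ⇒ p = q = 0`. [cite: Deligne1982HodgeCycles, §4 p. 30] -/
theorem coords_eq_zero (hR : R = X ^ 2 + C 5 * X + C 5) {p q : ℚ}
    (h : AdjoinRoot.of (realPolyQ R) p + AdjoinRoot.of (realPolyQ R) q * AdjoinRoot.root (realPolyQ R) = 0) :
    p = 0 ∧ q = 0 := by
  have hmonic : (realPolyQ R).Monic := by rw [realPolyQ_R5 hR]; monicity!
  have hdeg : (realPolyQ R).natDegree = 2 := by rw [realPolyQ_R5 hR]; compute_degree!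
  have hmk : (AdjoinRoot.mk (realPolyQ R) (C p + C q * X) : realField R) = 0 := by
    rw [map_add, map_mul, AdjoinRoot.mk_C, AdjoinRoot.mk_C, AdjoinRoot.mk_X]
    exact h
  rw [AdjoinRoot.mk_eq_zero] at hmk
  by_cases h0 : C p + C q * X = 0
  · have h1 := congrArg (fun f : Polynomial ℚ => f.coeff 0) h0
    have h2 := congrArg (fun f : Polynomial ℚ => f.coeff 1) h0
    simp at h1 h2
    exact ⟨h1, h2⟩
  · exfalso
    refine hmonic.not_dvd_of_natDegree_lt h0 ?_ hmk
    rw [hdeg]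
    have : (C p + C q * X).natDegree ≤ 1 := by compute_degree
    omega

/-- **No `a, b ∈ F` with `a² - σ b² = 3w`, `3 ∤ w`**: the norm form of `E/F` does not represent `3w`.
[folklore] -/
theorem sq_sub_root_mul_sq_ne (hR : R = X ^ 2 + C 5 * X + C 5) (w : ℤ) (hw : ¬ (3 : ℤ) ∣ w)
    (a b : realField R) :
    a ^ 2 - AdjoinRoot.root (realPolyQ R) * b ^ 2 ≠ AdjoinRoot.of (realPolyQ R) (3 * w) := by
  obtain ⟨a₀, a₁, rfl⟩ := exists_coords hR a
  obtain ⟨b₀, b₁, rfl⟩ := exists_coords hR b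
  have hσ := root_rel hR
  intro h
  -- collect coordinates on `{1, σ}`: `ι(X - 3w) + ι(Y) σ = 0`
  have key : AdjoinRoot.of (realPolyQ R) (a₀ ^ 2 - 5 * a₁ ^ 2 + 10 * b₀ * b₁ - 25 * b₁ ^ 2 - 3 * w) +
      AdjoinRoot.of (realPolyQ R) (2 * a₀ * a₁ - 5 * a₁ ^ 2 - b₀ ^ 2 + 10 * b₀ * b₁ - 20 * b₁ ^ 2) *
        AdjoinRoot.root (realPolyQ R) = 0 := by
    simp only [map_add, map_sub, map_mul, map_pow, map_ofNat] at h ⊢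
    linear_combination h - (AdjoinRoot.of (realPolyQ R) a₁ ^ 2
      - 2 * AdjoinRoot.of (realPolyQ R) b₀ * AdjoinRoot.of (realPolyQ R) b₁
      + 5 * AdjoinRoot.of (realPolyQ R) b₁ ^ 2
      - AdjoinRoot.of (realPolyQ R) b₁ ^ 2 * AdjoinRoot.root (realPolyQ R)) * hσ
  obtain ⟨hX, hY⟩ := coords_eq_zero hR key
  exact rat_no_solution w hw a₀ a₁ b₀ b₁ (by linarith) hY

/-- `z z̄ = ι(a² - σ b²)` for `z = ι a + ι b · η` (`η̄ = -η`, `η² = ι σ`). [cite: Deligne1982HodgeCycles, §4 p. 30] -/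
theorem norm_coords (a b : realField R) :
    (realToCM R a + realToCM R b * cmRoot R) * cmConj R (realToCM R a + realToCM R b * cmRoot R)
      = realToCM R (a ^ 2 - AdjoinRoot.root (realPolyQ R) * b ^ 2) := by
  rw [map_add, map_mul, cmConj_realToCM, cmConj_realToCM, cmConj_cmRoot, map_sub, map_mul, map_pow,
    map_pow, realToCM_root]
  ring

end Coordinates

/-! ### §4 The certificate on Deligne's carriers -/

/-- **`[3w] ≠ [(-1)²] = [1]` in `F^×/Nm_{E/F}(E^×)` for `E = ℚ(ζ₅) = ℚ[T]/(T⁴+5T²+5)`, `F = ℚ(√5) =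
ℚ[S]/(S²+5S+5)`, `3 ∤ w`**: the class of any `q ∈ F^×` with `q = 3w` is not the split class of `E`-rank `4`
(`HodgeTheory.splitDiscriminantClassCM R 2`). For the census: the Weil-type components
`(E = ℚ(ζ₅), d = 4, δ = [3]), [6], [15], [21], [24], [30], [33], [39], …` are NON-SPLIT (no `E`-Lagrangian
member, Deligne Cor. 4.2). The `Fact` instance argument is any proof that `S² + 5S + 5` is irreducible over
`ℚ` (e.g. `fact_irreducible_realPolyQ_R5 rfl`). [cite: Deligne1982HodgeCycles, §4 p. 30 (1) and Cor. 4.2]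
[cite: Landherr1936HermitianForms] -/
theorem zeta5_mk_three_mul_ne_splitDiscriminantClassCM {R : Polynomial ℤ} (hR : R = X ^ 2 + C 5 * X + C 5)
    [Fact (Irreducible (realPolyQ R))] (w : ℤ) (hw : ¬ (3 : ℤ) ∣ w) (q : (realField R)ˣ)
    (hq : (q : realField R) = AdjoinRoot.of (realPolyQ R) (3 * w)) :
    (QuotientGroup.mk q : cmNormResidueGroup R) ≠ splitDiscriminantClassCM R 2 := by
  haveI : Fact (Irreducible (cmPolyQ R)) := fact_irreducible_cmPolyQ_R5 hR
  intro h
  rw [splitDiscriminantClassCM, neg_one_sq] at h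
  obtain ⟨z, -, hz⟩ := exists_eq_ratCast_mul_norm_of_mk_eq (q := q) (u := 1) (c := 1)
    (by rw [Units.val_one, Rat.cast_one]) h
  rw [Rat.cast_one, one_mul] at hz
  obtain ⟨a, b, rfl⟩ := exists_eq_realToCM_add_mul_cmRoot R z
  rw [norm_coords, algebraMap_realField_eq, hq] at hz
  exact sq_sub_root_mul_sq_ne hR w hw a b ((realToCM R).injective hz).symm

/-- **`[3] ≠ [1]`**: the class of `3` itself (`w = 1`) — row `W8.ℚ(ζ₅).{(√5),(3)}` of the census, least
representative `δ = 3` — is a non-split component. [cite: Deligne1982HodgeCycles, §4 p. 30 (1) and Cor. 4.2] -/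
theorem zeta5_mk_three_ne_splitDiscriminantClassCM {R : Polynomial ℤ} (hR : R = X ^ 2 + C 5 * X + C 5)
    [Fact (Irreducible (realPolyQ R))] (q : (realField R)ˣ) (hq : (q : realField R) = 3) :
    (QuotientGroup.mk q : cmNormResidueGroup R) ≠ splitDiscriminantClassCM R 2 :=
  zeta5_mk_three_mul_ne_splitDiscriminantClassCM hR 1 (by norm_num) q (by rw [hq]; simp)

/-- The same in the shape met by `HasWeilDiscriminantCM` consumers: **no `z ∈ E = ℚ(ζ₅)` has `z z̄ = 3`**
(`3` is not a norm from `E` to `F = ℚ(√5)`). [cite: Deligne1982HodgeCycles, §4 p. 30] -/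
theorem zeta5_mul_cmConj_ne_three {R : Polynomial ℤ} (hR : R = X ^ 2 + C 5 * X + C 5)
    [Fact (Irreducible (realPolyQ R))] (z : cmField R) : z * cmConj R z ≠ 3 := by
  haveI : Fact (Irreducible (cmPolyQ R)) := fact_irreducible_cmPolyQ_R5 hR
  obtain ⟨a, b, rfl⟩ := exists_eq_realToCM_add_mul_cmRoot R z
  rw [norm_coords]
  intro h
  have h3 : realToCM R (AdjoinRoot.of (realPolyQ R) (3 * (1 : ℤ))) = 3 := by
    rw [Int.cast_one, mul_one, realToCM_of]
    exact map_ofNat (algebraMap ℚ (cmField R)) 3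
  rw [← h3] at h
  exact sq_sub_root_mul_sq_ne hR 1 (by norm_num) a b ((realToCM R).injective h)

/-- **Unconditional packaging** (no instance argument): with the `Fact` supplied by
`fact_irreducible_realPolyQ_R5`, for `R = S² + 5S + 5` LITERALLY, the class of `3` in
`F^×/Nm_{E/F}(E^×)` differs from the split class `[(-1)^2]`. [cite: Deligne1982HodgeCycles, §4 p. 30 (1) and Cor. 4.2] -/
theorem zeta5_three_nonsplit :
    haveI := fact_irreducible_realPolyQ_R5 (R := X ^ 2 + C 5 * X + C 5) rfl
    ∀ q : (realField (X ^ 2 + C 5 * X + C 5))ˣ, (q : realField (X ^ 2 + C 5 * X + C 5)) = 3 →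
      (QuotientGroup.mk q : cmNormResidueGroup (X ^ 2 + C 5 * X + C 5)) ≠
        splitDiscriminantClassCM (X ^ 2 + C 5 * X + C 5) 2 := by
  haveI := fact_irreducible_realPolyQ_R5 (R := X ^ 2 + C 5 * X + C 5) rfl
  exact fun q hq => zeta5_mk_three_ne_splitDiscriminantClassCM rfl q hq

end Summit.HodgeConjecture.HodgeConjecture.Ring2.WeilCoverageCM

end
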